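import Summits.RiemannHypothesis.RiemannHypothesis.Theses.SpectralTrace
import Literature.NumberTheory.LFunctions.WeilArchimedeanPositivityProofs
import HarnessLib

/-!
# RiemannHypothesis / SpectralTrace — the support item `WindowTraceToPositivity`

Route `RiemannHypothesis/SpectralTrace`, item stmt-RiemannHypothesis-11198 (`WindowTraceToPositivity`,
support, rank 9):

  `∀ A, Trace(A) → WeilPositivityOn (A / 2)`,

where `Trace(A)` says that some real family `γ : ι → ℝ` reproduces the Weil functional on every
Weil test supported in the window `[-A, A]`:
`HasSum (i ↦ ĝ(1/2 + iγ_i)) (W g)` (`ĝ = weilMellin g`, `W = weilFunctional`).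

Proof (Bochner direction of Weil's criterion, Bombieri 2000 §2 / Yoshida 1992 §2): for a Weil
test `g` supported in the half window `[-A/2, A/2]`, the test `k = g ⋆ g̃` is a Weil test
(`IsWeilTest.weilConv`, `IsWeilTest.weilReflect`) supported in `[-A, A]`
(`tsupport_weilConv_weilReflect_subset`), and on the critical line
`k̂(1/2 + it) = |ĝ(1/2 + it)|²` (`weilMellin_weilConv_weilReflect_half`). Hence the window trace
gives `HasSum (i ↦ |ĝ(1/2 + iγ_i)|²) (W k) = Q(g)`, so `Re Q(g)` is a sum of non-negative reals
and is `≥ 0` (`HasSum.nonneg`).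

References: E. Bombieri, *Remarks on Weil's quadratic functional in the theory of prime numbers I*,
Rend. Mat. Acc. Lincei (9) 11 (2000), §2 and Thm. 1; H. Yoshida, Adv. Stud. Pure Math. 21 (1992),
§2.
-/

noncomputable section

open Complex Set

namespace Summit.RiemannHypothesis.RiemannHypothesis.Theorems

open Literature.NumberTheory.LFunctions
open Summit.RiemannHypothesis.RiemannHypothesis.Theses.SpectralTrace

/-- **Bochner form of a window trace on the half window.** If a real family `γ` reproduces the
Weil functional on the Weil tests supported in `[-A, A]`, then for every Weil test `g` supported
in `[-A/2, A/2]` the squared transform is summable along `γ` with sum the energy: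
`HasSum (i ↦ |ĝ(1/2 + iγ_i)|²) (Re Q(g))`, `Q(g) = W(g ⋆ g̃)` (Bombieri 2000 §2; Yoshida 1992 §2:
`F̂(t) = |φ̂(t)|²` for `F = φ * φ̃`). [folklore] -/
theorem spectralTrace_hasSum_norm_sq_of_windowTrace {A : ℝ} {ι : Type*} {γ : ι → ℝ}
    (h : ∀ g : ℝ → ℂ, IsWeilTest g → tsupport g ⊆ Icc (-A) A →
      HasSum (fun i => weilMellin g (1 / 2 + (γ i : ℂ) * I)) (weilFunctional g))
    {g : ℝ → ℂ} (hg : IsWeilTest g) (hgs : tsupport g ⊆ Icc (-(A / 2)) (A / 2)) :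
    HasSum (fun i => ‖weilMellin g (1 / 2 + (γ i : ℂ) * I)‖ ^ 2) (weilQuadratic g).re := by
  have hk : IsWeilTest (weilConv g (weilReflect g)) := hg.weilConv hg.weilReflect
  have hks : tsupport (weilConv g (weilReflect g)) ⊆ Icc (-A) A :=
    (tsupport_weilConv_weilReflect_subset hg.2 hgs).trans
      (Icc_subset_Icc (by linarith) (by linarith))
  have hsumC : HasSum (fun i => (((‖weilMellin g (1 / 2 + (γ i : ℂ) * I)‖ ^ 2 : ℝ) : ℂ)))
      (weilFunctional (weilConv g (weilReflect g))) := by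
    simpa only [weilMellin_weilConv_weilReflect_half hg] using h _ hk hks
  have hsumR : HasSum (fun i => ‖weilMellin g (1 / 2 + (γ i : ℂ) * I)‖ ^ 2)
      (weilFunctional (weilConv g (weilReflect g))).re := by
    simpa only [Complex.reCLM_apply, Complex.ofReal_re] using hsumC.mapL Complex.reCLM
  unfold weilQuadratic
  exact hsumR

/-- **A window trace forces Weil positivity on the half window** (support item
stmt-RiemannHypothesis-11198, `WindowTraceToPositivity`, proved outright): for every `A`, if some
real family `γ : ι → ℝ` satisfies `HasSum (i ↦ ĝ(1/2 + iγ_i)) (W g)` for every Weil test `g`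
supported in `[-A, A]`, then `WeilPositivityOn (A / 2)`, i.e. `0 ≤ Re W(g ⋆ g̃)` for every Weil
test `g` supported in `[-A/2, A/2]` — `Re Q(g)` is the sum of the non-negative reals
`|ĝ(1/2 + iγ_i)|²` (`spectralTrace_hasSum_norm_sq_of_windowTrace`, `HasSum.nonneg`).
(Bombieri 2000 §2 / Thm. 1, easy direction of Weil's criterion, window by window.) [folklore] -/
theorem windowTraceToPositivity_proof : WindowTraceToPositivity := by
  unfold WindowTraceToPositivity
  intro A hA g hg hgs
  obtain ⟨ι, γ, h⟩ := hA
  exact (spectralTrace_hasSum_norm_sq_of_windowTrace h hg hgs).nonneg fun i => by positivity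

end Summit.RiemannHypothesis.RiemannHypothesis.Theorems

end
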